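import Mathlib

/-!
# Stub `stub_bookkeeping` of the line `Sketch` (doubling RG) for the crux
`TwoClocks.EquilibriumFastWindowLD` (stmt-AtomisticToContinuum-14440)

Pure real-analysis bookkeeping on an abstract window moment `M : ℝ → ℝ → ℕ → ℝ≥0∞`
(tilt `β`, window parameter `τ`, particle number `N`): a quadratic static seed
`M β τ N ≤ e^{Cβ²(N+1)}` at every window `τ > 0`, together with the dyadic doubling inequalities
`M β (2T) N ≤ e^{δ(N+1)} (M (β/2) T N)^{2(1+η)}` at all scales `T = 2ʲτ₀` (eventually in `N`,
for every slack `δ > 0`) with a uniform gain `η < 1`, give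
`∀ |β| ≤ β₀, ∀ ε > 0, ∃ τ > 0, ∃ N₀, ∀ N ≥ N₀, M β τ N ≤ e^{ε(N+1)}`.

The proof is the induction `M β (2ᵏτ₀) N ≤ e^{(δ + Cβ² rᵏ)(N+1)}` (eventually in `N`, every
`δ > 0`) with `r = q/4 < 1`, `q = 2(1+η)`, followed by choosing `k` with `Cβ² rᵏ ≤ ε/2`.
-/

noncomputable section

open MeasureTheory ProbabilityTheory Real Set Filter
open scoped ENNReal BigOperators

namespace Summit.AtomisticToContinuum.HydrodynamicLimit.Theorems.FastWindowRG

/-- Monotonicity of the exponent: if `a ≤ b` and `0 ≤ s` then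
`ofReal (exp (a * s)) ≤ ofReal (exp (b * s))`. -/
private lemma ofReal_exp_mul_mono {a b s : ℝ} (hab : a ≤ b) (hs : 0 ≤ s) :
    ENNReal.ofReal (Real.exp (a * s)) ≤ ENNReal.ofReal (Real.exp (b * s)) :=
  ENNReal.ofReal_le_ofReal (Real.exp_le_exp.2 (mul_le_mul_of_nonneg_right hab hs))

/-- The inductive dyadic bound: at scale `2ᵏ τ₀` the moment is bounded by
`e^{(δ + C β² rᵏ)(N+1)}` eventually in `N`, for every slack `δ > 0`, where `r = 2(1+η)/4`. -/
private lemma dyadic_bound (M : ℝ → ℝ → ℕ → ℝ≥0∞) {β₀ C τ₀ η : ℝ}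
    (hτ₀ : 0 < τ₀) (hη0 : 0 ≤ η)
    (hseed : ∀ β : ℝ, |β| ≤ β₀ → ∀ τ : ℝ, 0 < τ → ∀ N : ℕ,
      M β τ N ≤ ENNReal.ofReal (Real.exp (C * β ^ 2 * ((N : ℝ) + 1))))
    (hdbl : ∀ j : ℕ, ∀ β : ℝ, |β| ≤ β₀ → ∀ δ : ℝ, 0 < δ → ∃ N₀ : ℕ, ∀ N : ℕ, N₀ ≤ N →
      M β (2 * (2 ^ j * τ₀)) N ≤
        ENNReal.ofReal (Real.exp (δ * ((N : ℝ) + 1))) * M (β / 2) (2 ^ j * τ₀) N ^ (2 * (1 + η)))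
    (k : ℕ) :
    ∀ β : ℝ, |β| ≤ β₀ → ∀ δ : ℝ, 0 < δ → ∃ N₀ : ℕ, ∀ N : ℕ, N₀ ≤ N →
      M β (2 ^ k * τ₀) N ≤
        ENNReal.ofReal (Real.exp ((δ + C * β ^ 2 * (2 * (1 + η) / 4) ^ k) * ((N : ℝ) + 1))) := by
  induction k with
  | zero =>
    intro β hβ δ hδ
    refine ⟨0, fun N _ => ?_⟩
    have hN : (0 : ℝ) ≤ (N : ℝ) + 1 := by positivity
    calc M β (2 ^ 0 * τ₀) N = M β τ₀ N := by rw [pow_zero, one_mul]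
      _ ≤ ENNReal.ofReal (Real.exp (C * β ^ 2 * ((N : ℝ) + 1))) := hseed β hβ τ₀ hτ₀ N
      _ ≤ _ := by
        refine ofReal_exp_mul_mono ?_ hN
        rw [pow_zero, mul_one]
        linarith
  | succ k ih =>
    intro β hβ δ hδ
    set q : ℝ := 2 * (1 + η) with hq
    have hq0 : 0 < q := by rw [hq]; positivity
    have hqne : q ≠ 0 := hq0.ne'
    -- the doubling step with slack `δ/2`
    obtain ⟨N₁, hN₁⟩ := hdbl k β hβ (δ / 2) (by positivity)
    -- the inductive bound at `β/2` with slack `δ/(2q)`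
    have hβ' : |β / 2| ≤ β₀ := by
      rw [abs_div, abs_two]
      exact (half_le_self (abs_nonneg β)).trans hβ
    obtain ⟨N₂, hN₂⟩ := ih (β / 2) hβ' (δ / (2 * q)) (by positivity)
    refine ⟨max N₁ N₂, fun N hN => ?_⟩
    have hN1 : N₁ ≤ N := le_of_max_le_left hN
    have hN2 : N₂ ≤ N := le_of_max_le_right hN
    have h2 : (2 : ℝ) ^ (k + 1) * τ₀ = 2 * (2 ^ k * τ₀) := by ring
    rw [h2]
    refine (hN₁ N hN1).trans ?_
    -- the algebra of the exponents: `q (δ/(2q) + C (β/2)² rᵏ) = δ/2 + C β² rᵏ⁺¹`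
    have key : (δ / (2 * q) + C * (β / 2) ^ 2 * (q / 4) ^ k) * ((N : ℝ) + 1) * q
        = (δ / 2 + C * β ^ 2 * (q / 4) ^ (k + 1)) * ((N : ℝ) + 1) := by
      field_simp
      ring
    -- bound the power of the inductive estimate
    have hpow : M (β / 2) (2 ^ k * τ₀) N ^ q ≤
        ENNReal.ofReal (Real.exp ((δ / 2 + C * β ^ 2 * (q / 4) ^ (k + 1)) * ((N : ℝ) + 1))) := by
      calc M (β / 2) (2 ^ k * τ₀) N ^ q
          ≤ (ENNReal.ofReal (Real.exp ((δ / (2 * q) + C * (β / 2) ^ 2 * (q / 4) ^ k) *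
              ((N : ℝ) + 1)))) ^ q := ENNReal.rpow_le_rpow (hN₂ N hN2) hq0.le
        _ = ENNReal.ofReal (Real.exp ((δ / 2 + C * β ^ 2 * (q / 4) ^ (k + 1)) *
              ((N : ℝ) + 1))) := by
          rw [ENNReal.ofReal_rpow_of_pos (Real.exp_pos _), ← Real.exp_mul, key]
    calc ENNReal.ofReal (Real.exp (δ / 2 * ((N : ℝ) + 1))) * M (β / 2) (2 ^ k * τ₀) N ^ q
        ≤ ENNReal.ofReal (Real.exp (δ / 2 * ((N : ℝ) + 1))) *
          ENNReal.ofReal (Real.exp ((δ / 2 + C * β ^ 2 * (q / 4) ^ (k + 1)) *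
            ((N : ℝ) + 1))) := mul_le_mul_right hpow _
      _ = ENNReal.ofReal (Real.exp ((δ + C * β ^ 2 * (q / 4) ^ (k + 1)) * ((N : ℝ) + 1))) := by
          rw [← ENNReal.ofReal_mul (Real.exp_pos _).le, ← Real.exp_add]
          congr 2
          ring

/-- **S1 `stub_bookkeeping`** (pure real analysis). For an abstract window moment
`M : ℝ → ℝ → ℕ → ℝ≥0∞` (tilt, window parameter, `N`): a quadratic static seed at every window and
the dyadic doubling inequalities with a uniform gain `η < 1` give decay of the pressure in the sense
of the crux: for every `|β| ≤ β₀` and every `ε > 0` there is a window parameter `τ > 0` with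
`M β τ N ≤ e^{ε (N+1)}` eventually in `N`. -/
theorem stub_bookkeeping (M : ℝ → ℝ → ℕ → ℝ≥0∞) {β₀ C τ₀ η : ℝ} (hβ₀ : 0 < β₀) (hC : 0 ≤ C)
    (hτ₀ : 0 < τ₀) (hη0 : 0 ≤ η) (hη1 : η < 1)
    (hseed : ∀ β : ℝ, |β| ≤ β₀ → ∀ τ : ℝ, 0 < τ → ∀ N : ℕ,
      M β τ N ≤ ENNReal.ofReal (Real.exp (C * β ^ 2 * ((N : ℝ) + 1))))
    (hdbl : ∀ j : ℕ, ∀ β : ℝ, |β| ≤ β₀ → ∀ δ : ℝ, 0 < δ → ∃ N₀ : ℕ, ∀ N : ℕ, N₀ ≤ N →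
      M β (2 * (2 ^ j * τ₀)) N ≤
        ENNReal.ofReal (Real.exp (δ * ((N : ℝ) + 1))) * M (β / 2) (2 ^ j * τ₀) N ^ (2 * (1 + η))) :
    ∀ β : ℝ, |β| ≤ β₀ → ∀ ε : ℝ, 0 < ε → ∃ τ : ℝ, 0 < τ ∧ ∃ N₀ : ℕ, ∀ N : ℕ, N₀ ≤ N →
      M β τ N ≤ ENNReal.ofReal (Real.exp (ε * ((N : ℝ) + 1))) := by
  have _ := hβ₀
  intro β hβ ε hε
  have hr0 : (0 : ℝ) ≤ 2 * (1 + η) / 4 := by positivity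
  have hr1 : 2 * (1 + η) / 4 < 1 := by linarith
  -- choose `k` with `C β² rᵏ ≤ ε/2`
  have hpos : 0 < C * β ^ 2 + 1 := by positivity
  obtain ⟨k, hk⟩ := exists_pow_lt_of_lt_one (show 0 < ε / 2 / (C * β ^ 2 + 1) by positivity) hr1
  have hk' : C * β ^ 2 * (2 * (1 + η) / 4) ^ k ≤ ε / 2 := by
    have h1 := (lt_div_iff₀ hpos).1 hk
    nlinarith [pow_nonneg hr0 k, sq_nonneg β, h1]
  obtain ⟨N₀, hN₀⟩ := dyadic_bound M hτ₀ hη0 hseed hdbl k β hβ (ε / 2) (by positivity)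
  refine ⟨2 ^ k * τ₀, by positivity, N₀, fun N hN => ?_⟩
  have hNpos : (0 : ℝ) ≤ (N : ℝ) + 1 := by positivity
  refine (hN₀ N hN).trans (ofReal_exp_mul_mono ?_ hNpos)
  linarith

end Summit.AtomisticToContinuum.HydrodynamicLimit.Theorems.FastWindowRG

end
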